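import Mathlib

/-!
# Route OverlapGapAlgebra, crux `SearchHardWindow` (stmt-PneNP-2460): basic properties of the
# `ε`-resampling kernel

On a finite product space `ι → Γ` the `ε`-resampling ("noise") Markov kernel keeps each coordinate
with probability `1 − ε` and resamples it uniformly from `Γ` with probability `ε`, independently over
the coordinates (O'Donnell 2014, Def. 8.26; Huang–Sellke 2025 §3.3, "`p`-correlated copy,
`p = 1 − ε`"). Its transition weights are the explicit product
`P_ε(y, y') = ∏_i ((1 − ε)·[y i = y' i] + ε/|Γ|)`.

`stub_resampleKernelBasic` records, for `0 ≤ ε ≤ 1`, that this kernel is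
(a) nonnegative (each factor is `(1 − ε)·{0,1} + ε/|Γ| ≥ 0`, `Finset.prod_nonneg`),
(b) symmetric (`y i = y' i ↔ y' i = y i` factorwise), and
(c) stochastic: `∑_{y'} P_ε(y, y') = ∏_i ∑_{c : Γ} ((1 − ε)·[y i = c] + ε/|Γ|) = ∏_i 1 = 1`
(`Fintype.prod_sum` read right to left, then `(1 − ε)·1 + |Γ|·(ε/|Γ|) = 1` in each coordinate).
These three facts feed the abstract grand-correlation inequality of line `Sketch`.
-/

set_option linter.dupNamespace false -- `Summit.PneNP.PneNP.…`: summit = sub-problem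

namespace Summit.PneNP.PneNP.Theorems

open Finset

/-- One coordinate of the resampling kernel is a probability vector:
`∑_{c : Γ} ((1 − ε)·[a = c] + ε/|Γ|) = 1`. -/
theorem rsk_coord_sum_eq_one {Γ : Type*} [Fintype Γ] [DecidableEq Γ] [Nonempty Γ] (ε : ℝ)
    (a : Γ) : ∑ c : Γ, ((1 - ε) * (if a = c then (1 : ℝ) else 0) + ε / Fintype.card Γ) = 1 := by
  have hcard : (Fintype.card Γ : ℝ) ≠ 0 := by
    exact_mod_cast (Fintype.card_pos (α := Γ)).ne'
  rw [Finset.sum_add_distrib, ← Finset.mul_sum, Finset.sum_ite_eq, if_pos (Finset.mem_univ a),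
    Finset.sum_const, Finset.card_univ, nsmul_eq_mul, mul_div_cancel₀ _ hcard]
  ring

/-- One factor of the resampling kernel is nonnegative for `0 ≤ ε ≤ 1`. -/
theorem rsk_factor_nonneg {Γ : Type*} [Fintype Γ] [DecidableEq Γ] (ε : ℝ) (hε0 : 0 ≤ ε)
    (hε1 : ε ≤ 1) (a b : Γ) :
    0 ≤ (1 - ε) * (if a = b then (1 : ℝ) else 0) + ε / Fintype.card Γ := by
  have h1 : 0 ≤ (1 - ε) * (if a = b then (1 : ℝ) else 0) :=
    mul_nonneg (sub_nonneg.mpr hε1) (by split_ifs <;> norm_num)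
  have h2 : 0 ≤ ε / Fintype.card Γ := div_nonneg hε0 (Nat.cast_nonneg _)
  exact add_nonneg h1 h2

/-- **Basic properties of the `ε`-resampling kernel** on the finite product space `ι → Γ`
(O'Donnell 2014 Def. 8.26; Huang–Sellke 2025 §3.3): for `0 ≤ ε ≤ 1` the weights
`P_ε(y, y') = ∏_i ((1 − ε)·[y i = y' i] + ε/|Γ|)` are (a) nonnegative, (b) symmetric in `(y, y')`,
and (c) stochastic, `∑_{y'} P_ε(y, y') = 1`. -/
theorem stub_resampleKernelBasic {ι Γ : Type*} [Fintype ι] [DecidableEq ι] [Fintype Γ]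
    [DecidableEq Γ] [Nonempty Γ] (ε : ℝ) (hε0 : 0 ≤ ε) (hε1 : ε ≤ 1) :
    (∀ y y' : ι → Γ,
        0 ≤ ∏ i, ((1 - ε) * (if y i = y' i then (1 : ℝ) else 0) + ε / Fintype.card Γ)) ∧
    (∀ y y' : ι → Γ,
        (∏ i, ((1 - ε) * (if y i = y' i then (1 : ℝ) else 0) + ε / Fintype.card Γ)) =
          ∏ i, ((1 - ε) * (if y' i = y i then (1 : ℝ) else 0) + ε / Fintype.card Γ)) ∧
    (∀ y : ι → Γ,
        ∑ y' : ι → Γ, ∏ i, ((1 - ε) * (if y i = y' i then (1 : ℝ) else 0) + ε / Fintype.card Γ)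
          = 1) := by
  refine ⟨fun y y' => ?_, fun y y' => ?_, fun y => ?_⟩
  · exact Finset.prod_nonneg fun i _ => rsk_factor_nonneg ε hε0 hε1 (y i) (y' i)
  · refine Finset.prod_congr rfl fun i _ => ?_
    simp only [eq_comm]
  · rw [← Fintype.prod_sum (fun i (c : Γ) =>
      (1 - ε) * (if y i = c then (1 : ℝ) else 0) + ε / Fintype.card Γ)]
    exact Finset.prod_eq_one fun i _ => rsk_coord_sum_eq_one ε (y i)

end Summit.PneNP.PneNP.Theorems
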